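import Literature.AnabelianGeometry.EtaleTheta.Discharge.Sec2Prop214iiiMonoTranslations
import Literature.AnabelianGeometry.EtaleTheta.RigidOfSetting
import HarnessLib

/-!
# [EtTh] Prop 2.14 (iii), mono case: the automorphism over `Gal(Y/X)`-conjugation INDUCES conjugation on
# `Π^tp_Y` — in the currency `RigidData.Induces` of the typed statement `Prop214_iii_mono`

Mochizuki, *The Étale Theta Function …* [EtTh], Publ. RIMS 45 (2009), §2, Prop 2.14 (iii), PRIMS PDF
pp.49–50 (bib key `MochizukiEtTh2009`): "every automorphism of `M` induces an automorphism of `Π^tp_{Y̲̲}` …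
the resulting homomorphism … is surjective".

PROOF-ONLY companion (no `def`; seat abc-iut-L2-t2) of `ThetaRigidity.lean` (`RigidData.Induces`,
`Prop214_iii_mono`) and `Discharge/Sec2Prop214iiiMonoTranslations.lean`. Generic: an automorphism `α` of
`Π^tp_Y[μ_N]` whose `Π^tp_Y`-component is conjugation by `x ∈ Π^tp_X` INDUCES (in the sense of
`RigidData.Induces`) the bi-continuous automorphism "conjugation by `x`" of `Π^tp_Y`
(`RigidData.exists_induces_of_right_eq`). At abc-iut-L2-t8's §1 model (`DoubleUnderline.rigidData`): for
EVERY `x ∈ Π^tp_{X̲̲}` there are an automorphism `α` of the model mono-theta environment and an induced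
`a = conj(x)` on `Π^tp_{Y̲̲}` with `Induces α a` — the existence half of the surjectivity clause of
`Prop214_iii_mono` for the translation `x̄ ∈ Gal(Y̲̲/X̲̲) ≅ l·ℤ`, WITHOUT the cusp-label bookkeeping
`ActsOnCuspsBy` (no label equivariance in `CuspLabels`) and without the `{±1}`-part; conditional on
Prop 1.5 (ii), (iii) (+ `H2`, a theorem on towers). HONEST FRAMING: [EtTh] is refereed; no side is taken on
[IUTchIII] Cor 3.12; nothing beyond the displayed statements is claimed.
-/

noncomputable section

namespace Literature.AnabelianGeometry.EtaleTheta

open Literature.AnabelianGeometry.SemiGraphs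

universe u

namespace RigidData

variable {N : ℕ+} {l : ℕ} (R : RigidData.{u} N l)

/-- **An automorphism with `Π^tp_Y`-component `y ↦ x y x⁻¹` induces conjugation by `x` on `Π^tp_Y`**
(`RigidData.Induces`), the induced map being a bi-continuous automorphism of `Π^tp_Y`.
[cite: MochizukiEtTh2009, Prop 2.14(iii) p.49] -/
theorem exists_induces_of_right_eq (x : R.PiX) (α : MulAut R.env)
    (hα : ∀ z : R.env, (((α z).right : R.PiY) : R.PiX) = x * ((z.right : R.PiY) : R.PiX) * x⁻¹) :
    ∃ a : R.PiY ≃ₜ* R.PiY, R.Induces α a ∧ ∀ y : R.PiY, ((a y : R.PiY) : R.PiX) = x * (y : R.PiX) * x⁻¹ := by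
  haveI : R.PiY.Normal := R.PiY_normal
  have hcont : ∀ g : R.PiX, Continuous fun y : R.PiY => MulAut.conjNormal g y := fun g =>
    continuous_induced_rng.2 (by
      simp only [Function.comp_def, MulAut.conjNormal_apply]
      fun_prop)
  have hsymm : ∀ y : R.PiY, (MulAut.conjNormal (H := R.PiY) x).symm y = MulAut.conjNormal x⁻¹ y := by
    intro y
    rw [map_inv]
    rfl
  let a : R.PiY ≃ₜ* R.PiY :=
    { MulAut.conjNormal (H := R.PiY) x with
      continuous_toFun := hcont x
      continuous_invFun := by
        show Continuous fun y : R.PiY => (MulAut.conjNormal (H := R.PiY) x).symm y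
        simp only [hsymm]
        exact hcont x⁻¹ }
  refine ⟨a, fun z => Subtype.ext (hα z), fun y => rfl⟩

end RigidData

namespace ThetaSetting.EtaleThetaData.DoubleUnderline

variable {p : ℕ} [Fact p.Prime] {D : ThetaSetting p} {E : D.EtaleThetaData} {l : ℕ}
  (C : E.DoubleUnderline l)

/-- **Prop 2.14 (iii), mono case, at the §1 MODEL, in the typed currency**: for every `x ∈ Π^tp_{X̲̲}` and
every theta cocycle `η`, there are an automorphism `α` of the model mono-theta environment `M_N(η)` of
`R := C.rigidData μ hC hS h15 L` and a bi-continuous automorphism `a` of `Π^tp_{Y̲̲}` with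
`R.Induces α a`, `a = conj(x)` on `Π^tp_{Y̲̲}` and `α = χ(aug x)` on `μ_N` — conditional on Prop 1.5 (ii),
(iii) and the 2-torsion clause `H2`. (The cusp-label clause `ActsOnCuspsBy a s ε` of `Prop214_iii_mono` is
not derivable: `CuspLabels` carries no equivariance.) [cite: MochizukiEtTh2009, Prop 2.14(iii) p.50] -/
theorem exists_monoIso_induces_of_model {N : ℕ+} (μ : D.CyclotomeMod l N) (hC : D.Compat)
    (hS : D.Sec2Hyps) (h15 : Prop15iii E hC) (h15ii : Prop15ii E.toKummerData hC)
    (H2 : ∀ t : D.lDeltaTheta l, t ^ 2 = 1 → μ.red t = 1) (L : C.CuspLabels)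
    {η : (C.rigidData μ hC hS h15 L).PiYdd → (C.rigidData μ hC hS h15 L).mu}
    (hη : η ∈ (C.rigidData μ hC hS h15 L).thetaCocycles) (x : (C.rigidData μ hC hS h15 L).PiX) :
    ∃ (α : ((C.rigidData μ hC hS h15 L).modelMono hη).Iso ((C.rigidData μ hC hS h15 L).modelMono hη))
      (a : (C.rigidData μ hC hS h15 L).PiY ≃ₜ* (C.rigidData μ hC hS h15 L).PiY),
      (C.rigidData μ hC hS h15 L).Induces α.e.toMulEquiv a ∧
      (∀ y, ((a y : (C.rigidData μ hC hS h15 L).PiY) : (C.rigidData μ hC hS h15 L).PiX) =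
        x * (y : (C.rigidData μ hC hS h15 L).PiX) * x⁻¹) ∧
      ∀ m, α.e (CycEnvelope.inMu (C.rigidData μ hC hS h15 L).augY (C.rigidData μ hC hS h15 L).chi m) =
        CycEnvelope.inMu (C.rigidData μ hC hS h15 L).augY (C.rigidData μ hC hS h15 L).chi
          ((C.rigidData μ hC hS h15 L).chi ((C.rigidData μ hC hS h15 L).aug x) m) := by
  obtain ⟨α, hright, hmu⟩ := C.exists_monoIso_over_conj_of_model μ hC hS h15 h15ii H2 hη x
  obtain ⟨a, hind, ha⟩ :=
    (C.rigidData μ hC hS h15 L).exists_induces_of_right_eq x α.e.toMulEquiv (fun z => hright z)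
  exact ⟨α, a, hind, ha, hmu⟩

/-- The same at every level `M` of the model tower over a `CyclotomeTower` (`H2` discharged by
`CyclotomeTower.red_eq_one_of_sq_eq_one`): conditional on Prop 1.5 (ii), (iii) only.
[cite: MochizukiEtTh2009, Prop 2.14(iii) p.50] -/
theorem exists_monoIso_induces_of_model_tower {Es : Set ℕ+} (τ : D.CyclotomeTower l Es)
    (hC : D.Compat) (hS : D.Sec2Hyps) (h15 : Prop15iii E hC) (h15ii : Prop15ii E.toKummerData hC)
    (L : C.CuspLabels) (M : Es)
    {η : (C.rigidData (τ.mod M) hC hS h15 L).PiYdd → (C.rigidData (τ.mod M) hC hS h15 L).mu}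
    (hη : η ∈ (C.rigidData (τ.mod M) hC hS h15 L).thetaCocycles)
    (x : (C.rigidData (τ.mod M) hC hS h15 L).PiX) :
    ∃ (α : ((C.rigidData (τ.mod M) hC hS h15 L).modelMono hη).Iso
        ((C.rigidData (τ.mod M) hC hS h15 L).modelMono hη))
      (a : (C.rigidData (τ.mod M) hC hS h15 L).PiY ≃ₜ* (C.rigidData (τ.mod M) hC hS h15 L).PiY),
      (C.rigidData (τ.mod M) hC hS h15 L).Induces α.e.toMulEquiv a ∧
      (∀ y, ((a y : (C.rigidData (τ.mod M) hC hS h15 L).PiY) : (C.rigidData (τ.mod M) hC hS h15 L).PiX) =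
        x * (y : (C.rigidData (τ.mod M) hC hS h15 L).PiX) * x⁻¹) :=
  let ⟨α, a, h1, h2, _⟩ := C.exists_monoIso_induces_of_model (τ.mod M) hC hS h15 h15ii
    (τ.red_eq_one_of_sq_eq_one M) L hη x
  ⟨α, a, h1, h2⟩

end ThetaSetting.EtaleThetaData.DoubleUnderline

end Literature.AnabelianGeometry.EtaleTheta

end
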